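import Mathlib
import Summits.MatrixMultiplication.MatrixMultiplication.Theorems.SnSubsetDichotomyHyperoctahedralThresholdFarSymmetry

/-!
# The large-order ("free shift") symmetry regime of the open core `stub_poorRigidCore`
(crux `SnSubsetDichotomy.HyperoctahedralThreshold`, stmt-MatrixMultiplication-10883, live line
`Cruxes/HyperoctahedralThreshold/Lines/refutation_local_symmetry.lean`; siege k27, variation "direct pigeonhole")

Relation to the sibling file `…ThresholdLargeOrderSymmetry` (siege k25, landed minutes earlier, same deck-translate
counting in FINITE form for a permutation `θ` over the `4L+2` reflection supply): this file gives the regime in the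
QUANTIFIER SHAPE OF THE CORE (`∃ n₀ ∀ n ≥ n₀`, `|R|, |E| ≤ n^{3/4}`, conclusion verbatim — `stub_largeOrderSymmetry`),
for an arbitrary injective map `θ`, and in island form (`largeOrder_core` on a colour-closed `U`), over the `2r+2`
direct-pigeonhole supply of `FarSymmetry.exists_closedWalk_avoiding`.

Third of three regime files (`…InvolutiveSymmetry`, p115060; `…FarSymmetry`): `μ 0, μ 1, μ 2` involutions of
`Fin n`, words act on the right (`x · w := w.foldl (fun v c => μ c v) x`), trajectory `i ↦ x · w.take i`.

`θ` is an injective near-symmetry (commuting with the colours off an exceptional set) whose first `J` iterates are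
fixed-point-free, `J > (2 r + 2)²` — e.g. the deck transformation of a cyclic cover of degree `> (2 log₂ n + 4)²`,
or left translation by an element of large order on a Cayley host (crux NOTES §3 "CYCLIC COVERS": "for large `p`,
deck translates `θ^j W` of one closed walk `W` give twins directly — `W` meets `θ^j W` for `≤ |W|²` values of `j`").
Made `R`-robust and defect-tolerant here: over the `B`-free closed walk `z` (`|z| ≤ 2 (r + 1)`) supplied by the direct
pigeonhole `FarSymmetry.exists_closedWalk_avoiding`, an ordered pair of trajectory points `(y_s, y_t)` excludes at
most ONE shift `e ≤ J` (two shifts with `y_s = θ^[e] y_t` would fix `y_t` under a non-trivial iterate), so some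
`j ∈ [1, J]` is excluded by no pair and the twin rung walk `t ↦ (y_t, θ^[j] y_t)` is clean (`largeOrder_core`, island
form; `stub_largeOrderSymmetry`, the quantifier shape of the core with `n ≥ 2^110`, `|R|, |E| ≤ n^{3/4}`, conclusion
verbatim).  Not covered by the three files: symmetries of small order `3 ≤ d ≤ (2 log₂ n + 4)²` without an involution
(small odd cyclic covers, crux NOTES §5 (A)) and non-involutive short-displacement near-symmetries.  No poorness,
rigidity or expansion is used; no definitions are introduced.
-/

-- justification: the sub-namespace `…HyperoctahedralThreshold.FreeShiftSymmetry` repeats a path component (siblings' layout)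
set_option linter.dupNamespace false

namespace Summit.MatrixMultiplication.MatrixMultiplication.Theorems.HyperoctahedralThreshold.FreeShiftSymmetry

open Finset GoodTwin InvolutiveSymmetry FarSymmetry

variable {n : ℕ}

/-! ### Iterates of a near-symmetry -/

/-- Iterates of `θ` commute with a colour at `v` as soon as `θ` does at `v, θ v, …, θ^[j-1] v`. -/
theorem iterate_comm_apply (μ : Fin 3 → Equiv.Perm (Fin n)) (θ : Fin n → Fin n) (c : Fin 3) :
    ∀ (j : ℕ) (v : Fin n), (∀ i < j, θ (μ c (θ^[i] v)) = μ c (θ (θ^[i] v))) →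
      θ^[j] (μ c v) = μ c (θ^[j] v) := by
  intro j
  induction j with
  | zero => intro v _; rfl
  | succ j ih =>
    intro v h
    have h0 := h 0 (by omega)
    simp only [Function.iterate_zero, id_eq] at h0
    rw [Function.iterate_succ_apply, Function.iterate_succ_apply, h0]
    exact ih (θ v) fun i hi => by
      simpa only [Function.iterate_succ_apply] using h (i + 1) (by omega)

/-- **The large-order symmetry regime of the core, explicit form.**  `μ c` involutions of `Fin n`, `U` closed under
every `μ c`, `θ` an injective map, `R, B` sets and `J` a bound such that for every `v ∈ U ∖ B` and every `i ≤ J`: `θ`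
commutes with the colours at `θ^[i] v`, `θ^[i] v ∉ R`, and `θ^[i] v ≠ v` when `1 ≤ i` (the first `J` iterates of `θ`
are fixed-point-free at `v`).  If `|U|² + 3·2^r·(r+2)·|B| < 3·2^r·|U|` and `(2 (r + 1))² < J` then there is a clean
closed colour-walk of the rung graph avoiding `R` in the format of the conclusion of `stub_poorRigidCore`,
`2 ≤ k + 1 ≤ 2 (r + 1)` rungs: over the `B`-free closed walk `z` of `FarSymmetry.exists_closedWalk_avoiding`
(`|z| ≤ 2 (r + 1)`) each ordered pair of trajectory points `(y_s, y_t)` excludes at most ONE shift `e ≤ J`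
(`y_s = θ^[e] y_t` for two shifts would fix `y_t` under a non-trivial iterate), so some `j ∈ [1, J]` is excluded by
no pair, and the twin rung walk `t ↦ (y_t, θ^[j] y_t)` has no `θ^[j]`-chords: it is clean.  (Cyclic covers of degree
`> (2 log₂ n + 4)²`, Cayley hosts with an element of large order acting on the left — crux NOTES §3 "CYCLIC COVERS",
here `R`-robust and defect-tolerant; the involutive and far regimes are the sibling files.) [this line] -/
theorem largeOrder_core (n r J : ℕ) (μ : Fin 3 → Equiv.Perm (Fin n)) (hμ : ∀ c, μ c * μ c = 1)
    (U : Finset (Fin n)) (hU : ∀ c, ∀ x ∈ U, μ c x ∈ U) (θ : Fin n → Fin n) (hθ : Function.Injective θ)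
    (R B : Finset (Fin n))
    (hB : ∀ v ∈ U, v ∉ B → ∀ i ≤ J, (∀ c, θ (μ c (θ^[i] v)) = μ c (θ (θ^[i] v))) ∧ θ^[i] v ∉ R ∧
      (1 ≤ i → θ^[i] v ≠ v))
    (hcount : U.card * U.card + 3 * 2 ^ r * ((r + 2) * B.card) < 3 * 2 ^ r * U.card) (hJ : (2 * (r + 1)) ^ 2 < J) :
    ∃ (k : ℕ) (p q : Fin (k + 1) → Fin n) (col : Fin (k + 1) → Fin 3),
      (∀ i, p i ≠ q i) ∧
      (∀ i, (μ (col i) (p i) = p (i + 1) ∧ μ (col i) (q i) = q (i + 1)) ∨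
        (μ (col i) (p i) = q (i + 1) ∧ μ (col i) (q i) = p (i + 1))) ∧
      (∀ i, col i ≠ col (i + 1)) ∧
      (∀ i j, (p i = p j ∧ q i = q j) ∨ (p i = q j ∧ q i = p j) ∨
        (p i ≠ p j ∧ p i ≠ q j ∧ q i ≠ p j ∧ q i ≠ q j)) ∧
      (∀ i, p i ∉ R ∧ q i ∉ R) ∧ 2 ≤ k + 1 ∧ k + 1 ≤ 2 * (r + 1) := by
  classical
  obtain ⟨x, hxX, y, z, hz0, hzc, hzlen, hfix, hP⟩ :=
    exists_closedWalk_avoiding n r μ hμ U U B hU (subset_refl U) hcount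
  have hℓ2 : 2 ≤ z.length := by
    match z, hz0, hzc with
    | [c], _, hc => simp at hc
    | _ :: _ :: _, _, _ => simp
  obtain ⟨k, hk⟩ : ∃ k, z.length = k + 1 := ⟨z.length - 1, by omega⟩
  have hval : ∀ t : Fin (k + 1), ((t + 1 : Fin (k + 1)) : ℕ) = ((t : ℕ) + 1) % z.length := by
    intro t
    rw [Fin.val_add, hk]
    simp
  set Pt : Fin (k + 1) → Fin n := fun t => (z.take (t : ℕ)).foldl (fun v c => μ c v) y with hPt
  -- trajectory points are `B`-free points of `U`
  have hPU : ∀ t : Fin (k + 1), Pt t ∈ U ∧ Pt t ∉ B := by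
    intro t
    obtain ⟨α, -, hα, hαB⟩ := hP t
    have h1 : Pt t = α.foldl (fun v c => μ c v) x := hα
    refine ⟨h1 ▸ foldl_mem μ U hU α x hxX, ?_⟩
    rw [h1, ← List.take_length (l := α)]
    exact hαB _
  have hθP : ∀ t : Fin (k + 1), ∀ i ≤ J, (∀ c, θ (μ c (θ^[i] (Pt t))) = μ c (θ (θ^[i] (Pt t)))) ∧
      θ^[i] (Pt t) ∉ R ∧ (1 ≤ i → θ^[i] (Pt t) ≠ Pt t) := fun t => hB _ (hPU t).1 (hPU t).2
  -- each ordered pair of trajectory points excludes at most one shift `e ≤ J`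
  let Sh : Fin (k + 1) × Fin (k + 1) → Finset ℕ := fun st =>
    (range (J + 1)).filter fun e => Pt st.1 = θ^[e] (Pt st.2)
  have key : ∀ st : Fin (k + 1) × Fin (k + 1), ∀ e e' : ℕ, e' ≤ J → Pt st.1 = θ^[e] (Pt st.2) →
      Pt st.1 = θ^[e'] (Pt st.2) → e < e' → False := by
    intro st e e' he' he hee' hlt
    have hfix' : θ^[e' - e] (Pt st.2) = Pt st.2 := by
      apply hθ.iterate e
      rw [← Function.iterate_add_apply, Nat.add_sub_cancel' hlt.le, ← hee', he]
    exact (hθP st.2 (e' - e) (by omega)).2.2 (by omega) hfix'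
  have hSh : ∀ st, (Sh st).card ≤ 1 := by
    intro st
    refine card_le_one.2 fun e he e' he' => ?_
    simp only [Sh, mem_filter, mem_range] at he he'
    by_contra hne
    rcases Nat.lt_or_gt_of_ne hne with hlt | hlt
    · exact key st e e' (by omega) he.2 he'.2 hlt
    · exact key st e' e (by omega) he'.2 he.2 hlt
  let BadJ : Finset ℕ := (univ : Finset (Fin (k + 1) × Fin (k + 1))).biUnion Sh
  have hBadJ : BadJ.card ≤ (2 * (r + 1)) ^ 2 := by
    calc BadJ.card ≤ (univ : Finset (Fin (k + 1) × Fin (k + 1))).card * 1 := card_biUnion_le_card_mul _ _ _ fun st _ => hSh st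
      _ = (k + 1) ^ 2 := by rw [card_univ, Fintype.card_prod, Fintype.card_fin]; ring
      _ ≤ (2 * (r + 1)) ^ 2 := Nat.pow_le_pow_left (by omega) 2
  -- a good shift `j ∈ [1, J]`
  obtain ⟨j, hj⟩ : ((Icc 1 J) \ BadJ).Nonempty := by
    rw [← card_pos]
    have := card_le_card_sdiff_add_card (s := Icc 1 J) (t := BadJ)
    rw [Nat.card_Icc] at this
    omega
  simp only [mem_sdiff, mem_Icc] at hj
  have nochord : ∀ s t : Fin (k + 1), Pt s ≠ θ^[j] (Pt t) := fun s t h =>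
    hj.2 (mem_biUnion.2 ⟨(s, t), mem_univ _, mem_filter.2 ⟨mem_range.2 (by omega), h⟩⟩)
  refine ⟨k, Pt, fun t => θ^[j] (Pt t), fun t => z[(t : ℕ)]'(by omega), fun t => nochord t t, ?_, ?_, ?_, ?_,
    by omega, by omega⟩
  · intro t
    dsimp only
    left
    have step : μ z[(t : ℕ)] (Pt t) = Pt (t + 1) := by
      simp only [hPt]
      rw [foldl_take_step μ z y hfix t (by omega), hval]
    refine ⟨step, ?_⟩
    rw [← step]
    exact (iterate_comm_apply μ θ _ j (Pt t) fun i hi => (hθP t i (by omega)).1 _).symm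
  · intro t
    exact cyclic_ne hzc t _ (by omega) (by rw [hval]; exact Nat.mod_lt _ (by omega)) (hval t)
  · intro s t
    dsimp only
    by_cases h1 : Pt s = Pt t
    · exact Or.inl ⟨h1, by rw [h1]⟩
    · exact Or.inr (Or.inr ⟨h1, nochord s t, fun h => nochord t s h.symm, fun h => h1 (hθ.iterate j h)⟩)
  · exact fun t => ⟨by simpa using (hθP t 0 (by omega)).2.1, (hθP t j hj.1.2).2.1⟩

/-- Numerics of the scale for the large-order regime: `(24 (m + 3)³)⁴ ≤ 2^m` for `m ≥ 110` (twelve base cases, then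
`m + 15 ≤ 2 (m + 3)` gives the step `m ↦ m + 12`). -/
theorem numeric_key24 : ∀ m, 110 ≤ m → (24 * (m + 3) ^ 3) ^ 4 ≤ 2 ^ m := by
  intro m
  induction m using Nat.strong_induction_on with
  | _ m ih =>
    intro hm
    rcases Nat.lt_or_ge m 122 with h | h
    · interval_cases m <;> norm_num
    · have ih' := ih (m - 12) (by omega) (by omega)
      calc (24 * (m + 3) ^ 3) ^ 4 ≤ (24 * (2 * (m - 12 + 3)) ^ 3) ^ 4 := by gcongr; omega
        _ = 2 ^ 12 * (24 * (m - 12 + 3) ^ 3) ^ 4 := by ring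
        _ ≤ 2 ^ 12 * 2 ^ (m - 12) := Nat.mul_le_mul_left _ ih'
        _ = 2 ^ m := by rw [← pow_add]; congr 1; omega

/-- **The large-order symmetry regime of `stub_poorRigidCore`** (registered `--supports` form
`stub_largeOrderSymmetry`; the core's conclusion verbatim, its host and forbidden-set hypotheses verbatim, poorness
and rigidity NOT needed): for `n ≥ 2^110`, three fixed-point-free involutions `μ i`, `|R| ≤ n^{3/4}`, and an
injective map `θ` which off an exceptional set `|E| ≤ n^{3/4}` commutes with the three colours and whose first
`(2 ⌊log₂ n⌋ + 4)² + 1` iterates are fixed-point-free there, there is a clean closed colour-walk of the rung graph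
avoiding `R` with `k + 1 ≤ n^{1/4}` rungs.  Proof: `largeOrder_core` on `U = univ` at `r = ⌊log₂ n⌋ + 1`,
`J = (2 r + 2)² + 1`, with `B := ⋃_{i ≤ J} (θ^[i])⁻¹(R ∪ E)` (`|B| ≤ (J + 1)(|R| + |E|)`,
`3 (r + 2) |B| ≤ 24 (r + 2)³ n^{3/4} ≤ n` and `k + 1 ≤ 2 r + 2 ≤ n^{1/4}` by `numeric_key24`). [this line] -/
theorem stub_largeOrderSymmetry : ∃ n₀ : ℕ, ∀ n ≥ n₀, ∀ μ : Fin 3 → Equiv.Perm (Fin n), (∀ i, μ i * μ i = 1 ∧ ∀ v, μ i v ≠ v) → ∀ R : Finset (Fin n), (R.card : ℝ) ≤ (n : ℝ) ^ ((3 : ℝ) / 4) → ∀ (θ : Fin n → Fin n) (E : Finset (Fin n)), Function.Injective θ → (E.card : ℝ) ≤ (n : ℝ) ^ ((3 : ℝ) / 4) → (∀ x, x ∉ E → (∀ c, θ (μ c x) = μ c (θ x)) ∧ ∀ i, 1 ≤ i → i ≤ (2 * Nat.log 2 n + 4) ^ 2 + 1 → θ^[i] x ≠ x) → ∃ (k :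 ℕ) (p q : Fin (k + 1) → Fin n) (col : Fin (k + 1) → Fin 3), (∀ i, p i ≠ q i) ∧ (∀ i, (μ (col i) (p i) = p (i + 1) ∧ μ (col i) (q i) = q (i + 1)) ∨ (μ (col i) (p i) = q (i + 1) ∧ μ (col i) (q i) = p (i + 1))) ∧ (∀ i, col i ≠ col (i + 1)) ∧ (∀ i j, (p i = p j ∧ q i = q j) ∨ (p i = q j ∧ q i = p j) ∨ (p i ≠ p j ∧ p i ≠ q j ∧ q i ≠ p j ∧ q i ≠ q j)) ∧ (∀ i, p i ∉ R ∧ q i ∉ R) ∧ ((k : ℝ) + 1) ≤ (n : ℝ) ^ ((1 : ℝ) / 4) := by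
  refine ⟨2 ^ 110, fun n hn μ hμ R hR θ E hθ hE hθE => ?_⟩
  classical
  -- the scale `m = ⌊log₂ n⌋`, `r = m + 1`, `J = (2 m + 4)² + 1`
  set m := Nat.log 2 n with hm
  have hn0 : n ≠ 0 := by rintro rfl; exact absurd hn (by norm_num)
  have h2m : 2 ^ m ≤ n := Nat.pow_log_le_self 2 hn0
  have hn2 : n < 2 ^ (m + 1) := Nat.lt_pow_succ_log_self one_lt_two n
  have key : (24 * (m + 3) ^ 3) ^ 4 ≤ n := (numeric_key24 m (Nat.le_log_of_pow_le one_lt_two hn)).trans h2m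
  set J := (2 * m + 4) ^ 2 + 1 with hJ
  -- the bad set `B := ⋃_{i ≤ J} (θ^[i])⁻¹(R ∪ E)`
  let B : Finset (Fin n) := (range (J + 1)).biUnion fun i => univ.filter fun x => θ^[i] x ∈ R ∪ E
  have hBR : ∀ v ∈ (univ : Finset (Fin n)), v ∉ B → ∀ i ≤ J,
      (∀ c, θ (μ c (θ^[i] v)) = μ c (θ (θ^[i] v))) ∧ θ^[i] v ∉ R ∧ (1 ≤ i → θ^[i] v ≠ v) := by
    intro v _ hv i hi
    have hvi : ∀ i ≤ J, θ^[i] v ∉ R ∧ θ^[i] v ∉ E := fun i hi => by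
      have : θ^[i] v ∉ R ∪ E := fun h =>
        hv (mem_biUnion.2 ⟨i, mem_range.2 (by omega), mem_filter.2 ⟨mem_univ _, h⟩⟩)
      simpa only [mem_union, not_or] using this
    have hv0 : v ∉ E := by simpa using (hvi 0 (by omega)).2
    exact ⟨fun c => (hθE _ (hvi i hi).2).1 c, (hvi i hi).1, fun h1 => (hθE v hv0).2 i h1 (by omega)⟩
  have hBcard : B.card ≤ (J + 1) * (R.card + E.card) := by
    calc B.card ≤ (range (J + 1)).card * (R ∪ E).card := card_biUnion_le_card_mul _ _ _ fun i _ =>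
          card_le_card_of_injOn (θ^[i]) (fun x hx => (mem_filter.1 (mem_coe.1 hx)).2) (hθ.iterate i).injOn
      _ ≤ (J + 1) * (R.card + E.card) := by rw [card_range]; exact Nat.mul_le_mul_left _ (card_union_le _ _)
  -- `24 (m + 3)³ ≤ n^{1/4}`, hence `3 (m + 3) |B| ≤ n`
  have hnpos : (0 : ℝ) < n := by exact_mod_cast Nat.pos_of_ne_zero hn0
  have hkey : ((24 * (m + 3) ^ 3 : ℕ) : ℝ) ≤ (n : ℝ) ^ ((1 : ℝ) / 4) := by
    have h1 : (((24 * (m + 3) ^ 3 : ℕ) : ℝ)) ^ 4 ≤ (n : ℝ) := by exact_mod_cast key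
    have e : ((((24 * (m + 3) ^ 3 : ℕ) : ℝ)) ^ 4) ^ ((1 : ℝ) / 4) = ((24 * (m + 3) ^ 3 : ℕ) : ℝ) := by
      rw [one_div]
      exact Real.pow_rpow_inv_natCast (by positivity) four_ne_zero
    exact e.symm.trans_le (Real.rpow_le_rpow (by positivity) h1 (by norm_num))
  have hJ3 : 3 * (m + 3) * ((J + 1) * (R.card + E.card)) ≤ 24 * (m + 3) ^ 3 * (R.card + E.card) / 2 := by
    rw [Nat.le_div_iff_mul_le two_pos]
    have : 2 * (3 * (J + 1)) ≤ 24 * (m + 3) ^ 2 := by rw [hJ]; ring_nf; nlinarith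
    calc 3 * (m + 3) * ((J + 1) * (R.card + E.card)) * 2 = (2 * (3 * (J + 1))) * ((m + 3) * (R.card + E.card)) := by
          ring
      _ ≤ 24 * (m + 3) ^ 2 * ((m + 3) * (R.card + E.card)) := Nat.mul_le_mul_right _ this
      _ = 24 * (m + 3) ^ 3 * (R.card + E.card) := by ring
  have hB3 : ((3 * (m + 3) * B.card : ℕ) : ℝ) ≤ n := by
    have hRE : ((R.card + E.card : ℕ) : ℝ) ≤ 2 * (n : ℝ) ^ ((3 : ℝ) / 4) := by push_cast; linarith
    have h24 : ((24 * (m + 3) ^ 3 * (R.card + E.card) / 2 : ℕ) : ℝ) ≤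
        ((24 * (m + 3) ^ 3 : ℕ) : ℝ) * (n : ℝ) ^ ((3 : ℝ) / 4) := by
      calc ((24 * (m + 3) ^ 3 * (R.card + E.card) / 2 : ℕ) : ℝ)
          ≤ ((24 * (m + 3) ^ 3 * (R.card + E.card) : ℕ) : ℝ) / 2 := Nat.cast_div_le
        _ = ((24 * (m + 3) ^ 3 : ℕ) : ℝ) * (((R.card + E.card : ℕ) : ℝ) / 2) := by push_cast; ring
        _ ≤ ((24 * (m + 3) ^ 3 : ℕ) : ℝ) * ((n : ℝ) ^ ((3 : ℝ) / 4)) := by gcongr; linarith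
    calc ((3 * (m + 3) * B.card : ℕ) : ℝ) ≤ ((3 * (m + 3) * ((J + 1) * (R.card + E.card)) : ℕ) : ℝ) := by
          exact_mod_cast Nat.mul_le_mul_left _ hBcard
      _ ≤ ((24 * (m + 3) ^ 3 * (R.card + E.card) / 2 : ℕ) : ℝ) := by exact_mod_cast hJ3
      _ ≤ ((24 * (m + 3) ^ 3 : ℕ) : ℝ) * (n : ℝ) ^ ((3 : ℝ) / 4) := h24
      _ ≤ (n : ℝ) ^ ((1 : ℝ) / 4) * (n : ℝ) ^ ((3 : ℝ) / 4) := by gcongr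
      _ = n := by rw [← Real.rpow_add hnpos]; norm_num
  have hB3' : 3 * (m + 3) * B.card ≤ n := by exact_mod_cast hB3
  -- the counting hypothesis at `r = m + 1`, `U = univ`
  have hcount : n * n + 3 * 2 ^ (m + 1) * ((m + 1 + 2) * B.card) < 3 * 2 ^ (m + 1) * n := by
    have h2 : 2 ^ (m + 1) ≤ 2 * n := by rw [pow_succ]; omega
    have h3 : 3 * 2 ^ (m + 1) * ((m + 1 + 2) * B.card) ≤ 2 * n * n := by
      calc 3 * 2 ^ (m + 1) * ((m + 1 + 2) * B.card) = 2 ^ (m + 1) * (3 * (m + 3) * B.card) := by ring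
        _ ≤ (2 * n) * n := Nat.mul_le_mul h2 hB3'
        _ = 2 * n * n := by ring
    have h4 : 3 * (n + 1) * n ≤ 3 * 2 ^ (m + 1) * n := Nat.mul_le_mul_right _ (Nat.mul_le_mul_left _ hn2)
    have h5 : 0 < n := Nat.pos_of_ne_zero hn0
    nlinarith
  obtain ⟨k, p, q, col, h1, h2, h3, h4, h5, -, h7⟩ := largeOrder_core n (m + 1) J μ (fun c => (hμ c).1) univ
    (fun c x _ => mem_univ _) θ hθ R B hBR (by rw [card_univ, Fintype.card_fin]; exact hcount)
    (by rw [hJ]; ring_nf; omega)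
  refine ⟨k, p, q, col, h1, h2, h3, h4, h5, le_trans ?_ hkey⟩
  have : k + 1 ≤ 24 * (m + 3) ^ 3 := by nlinarith
  exact_mod_cast this

end Summit.MatrixMultiplication.MatrixMultiplication.Theorems.HyperoctahedralThreshold.FreeShiftSymmetry
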